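import Mathlib
import HarnessLib

/-!
# `HeteroclinicTriggerChain` — crux `TriggerChainFrontStep` (item stmt-NavierStokesRegularity-22785):
  the SEEDED two-shell truncation — sign structure and the seed-deposit lower bound

First brick of the hop-map analysis (layer-2 child C₁ of the route text) on the two-shell truncation of the
pinned table `α₀ + βσ` (modes: carrier `x = X_{i₀,n}`, trigger `u = X_{i₁,n}`, receiver `y = X_{i₀,n+1}`,
upper trigger `v = X_{i₁,n+1}`; rates `e, g` at shell `n`, `e' = 2^{5/2} e` at shell `n+1`, seed `β`):
`x′ = −eu² − βuv`, `u′ = exu − guy`, `y′ = gu² − e′yv²`, `v′ = βxu + e′yv` (energy-conserving). Proved,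
by integrating-factor identities (no ODE-uniqueness appeal):
* the trigger never changes sign: `u(t) = u(0)·exp(∫₀ᵗ (ex − gy))`;
* the receiver stays nonnegative forward in time (`y ≥ 0`), and so does the upper trigger while the
  carrier is nonnegative (`v ≥ 0` on `[0,T]`);
* **seed deposit**: `v(T) ≥ v(0) + β ∫₀ᵀ x u` — during the hop the upper trigger receives at least the
  time-integral of the seed forcing `βxu` (the `e′yv` amplification only adds), the quantity behind the
  `log(1/β)/e` delay of the next hop and the premature-ignition numerics of the route text.

HONEST FRAMING: elementary facts about a four-dimensional quadratic ODE; helper for the crux, no stub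
credit; nothing here is a statement about the Navier–Stokes equations; no summit, rung or crux is proved.
-/

noncomputable section

set_option linter.dupNamespace false

open Real Set MeasureTheory intervalIntegral

namespace Summit.NavierStokesRegularity.NavierStokesRegularity.Theorems

/-- Antiderivative of a continuous function: `t ↦ ∫₀ᵗ f` has derivative `f t` everywhere. [folklore] -/
theorem htcST_hasDerivAt_primitive {f : ℝ → ℝ} (hf : Continuous f) (t : ℝ) :
    HasDerivAt (fun s => ∫ τ in (0 : ℝ)..s, f τ) (f t) t :=
  intervalIntegral.integral_hasDerivAt_right (hf.intervalIntegrable 0 t)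
    (hf.stronglyMeasurableAtFilter volume (nhds t)) hf.continuousAt

/-- **Trigger sign is invariant** in the seeded two-shell truncation: `u(t) = u(0)·exp(∫₀ᵗ (e x − g y))`
for every real `t` (integrating factor; `x`, `y` only need to be continuous). [folklore] -/
theorem heteroclinicTriggerChain_trunc_trigger_formula (e g : ℝ) (x u y : ℝ → ℝ)
    (hxc : Continuous x) (hyc : Continuous y)
    (hu : ∀ t, HasDerivAt u (e * x t * u t - g * u t * y t) t) (t : ℝ) :
    u t = u 0 * Real.exp (∫ s in (0 : ℝ)..t, (e * x s - g * y s)) := by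
  have hfc : Continuous fun s => e * x s - g * y s :=
    (continuous_const.mul hxc).sub (continuous_const.mul hyc)
  have hΦ := htcST_hasDerivAt_primitive hfc
  -- D := u · exp(−Φ) has zero derivative
  have hD : ∀ s, HasDerivAt (fun r => u r * Real.exp (-(∫ τ in (0 : ℝ)..r, (e * x τ - g * y τ))))
      0 s := by
    intro s
    have h := (hu s).mul ((hΦ s).neg.exp)
    refine h.congr_deriv ?_
    ring
  have hconst := is_const_of_deriv_eq_zero (fun s => (hD s).differentiableAt) (fun s => (hD s).deriv) t 0
  simp only [intervalIntegral.integral_same, neg_zero, Real.exp_zero, mul_one] at hconst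
  have hpos : 0 < Real.exp (∫ s in (0 : ℝ)..t, (e * x s - g * y s)) := Real.exp_pos _
  rw [Real.exp_neg] at hconst
  field_simp at hconst
  linarith [hconst]

/-- **The receiver stays nonnegative** forward in time: if `y′ = gu² − e′yv²` with `g ≥ 0` and
`y(0) ≥ 0` then `y(t) ≥ 0` for `t ≥ 0` (integrating factor `exp ∫ e′v²`). [folklore] -/
theorem heteroclinicTriggerChain_trunc_receiver_nonneg (g e' : ℝ) (hg : 0 ≤ g) (u y v : ℝ → ℝ)
    (hvc : Continuous v)
    (hy : ∀ t, HasDerivAt y (g * u t ^ 2 - e' * y t * v t ^ 2) t) (hy0 : 0 ≤ y 0) :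
    ∀ t, 0 ≤ t → 0 ≤ y t := by
  have hfc : Continuous fun s => e' * v s ^ 2 := continuous_const.mul (hvc.pow 2)
  have hΦ := htcST_hasDerivAt_primitive hfc
  have hZ : ∀ s, HasDerivAt (fun r => y r * Real.exp (∫ τ in (0 : ℝ)..r, e' * v τ ^ 2))
      (g * u s ^ 2 * Real.exp (∫ τ in (0 : ℝ)..s, e' * v τ ^ 2)) s := by
    intro s
    have h := (hy s).mul (hΦ s).exp
    refine h.congr_deriv ?_
    ring
  have hmono : Monotone fun r => y r * Real.exp (∫ τ in (0 : ℝ)..r, e' * v τ ^ 2) :=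
    monotone_of_deriv_nonneg (fun s => (hZ s).differentiableAt) fun s => by
      rw [(hZ s).deriv]
      positivity
  intro t ht
  have h := hmono ht
  simp only [intervalIntegral.integral_same, Real.exp_zero, mul_one] at h
  have hpos : 0 < Real.exp (∫ τ in (0 : ℝ)..t, e' * v τ ^ 2) := Real.exp_pos _
  nlinarith

/-- **SEED DEPOSIT in the seeded two-shell truncation** (helper for item stmt-NavierStokesRegularity-22785).
For the system `x′ = −eu² − βuv`, `u′ = exu − guy`, `y′ = gu² − e′yv²`, `v′ = βxu + e′yv` with `g, e′, β ≥ 0`,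
a pre-hop state `u(0) > 0`, `y(0) ≥ 0`, `v(0) ≥ 0`, and a window `[0,T]` on which the carrier stays
nonnegative: the trigger stays positive, the receiver and the upper trigger stay nonnegative, and the upper
trigger collects at least the seed forcing: `v(T) ≥ v(0) + β ∫₀ᵀ x u`. [folklore] -/
theorem heteroclinicTriggerChain_trunc_seed_deposit (e g e' β : ℝ) (hg : 0 ≤ g) (he' : 0 ≤ e') (hβ : 0 ≤ β)
    (x u y v : ℝ → ℝ)
    (hx : ∀ t, HasDerivAt x (-(e * u t ^ 2) - β * u t * v t) t)
    (hu : ∀ t, HasDerivAt u (e * x t * u t - g * u t * y t) t)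
    (hy : ∀ t, HasDerivAt y (g * u t ^ 2 - e' * y t * v t ^ 2) t)
    (hv : ∀ t, HasDerivAt v (β * x t * u t + e' * y t * v t) t)
    (hu0 : 0 < u 0) (hy0 : 0 ≤ y 0) (hv0 : 0 ≤ v 0) {T : ℝ} (hT : 0 ≤ T)
    (hxT : ∀ s ∈ Icc 0 T, 0 ≤ x s) :
    (∀ t, 0 < u t) ∧ (∀ t, 0 ≤ t → 0 ≤ y t) ∧ (∀ t ∈ Icc 0 T, 0 ≤ v t) ∧
      v 0 + β * ∫ s in (0 : ℝ)..T, x s * u s ≤ v T := by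
  have hxc : Continuous x := continuous_iff_continuousAt.2 fun t => (hx t).continuousAt
  have huc : Continuous u := continuous_iff_continuousAt.2 fun t => (hu t).continuousAt
  have hyc : Continuous y := continuous_iff_continuousAt.2 fun t => (hy t).continuousAt
  have hvc : Continuous v := continuous_iff_continuousAt.2 fun t => (hv t).continuousAt
  -- trigger sign
  have hupos : ∀ t, 0 < u t := fun t => by
    rw [heteroclinicTriggerChain_trunc_trigger_formula e g x u y hxc hyc hu t]
    exact mul_pos hu0 (Real.exp_pos _)
  -- receiver sign
  have hynn : ∀ t, 0 ≤ t → 0 ≤ y t :=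
    heteroclinicTriggerChain_trunc_receiver_nonneg g e' hg u y v hvc hy hy0
  -- upper trigger sign on [0, T], via W := v · exp(−∫ e' y)
  have hfc : Continuous fun s => e' * y s := continuous_const.mul hyc
  have hΦ := htcST_hasDerivAt_primitive hfc
  have hW : ∀ s, HasDerivAt (fun r => v r * Real.exp (-(∫ τ in (0 : ℝ)..r, e' * y τ)))
      (β * x s * u s * Real.exp (-(∫ τ in (0 : ℝ)..s, e' * y τ))) s := by
    intro s
    have h := (hv s).mul (hΦ s).neg.exp
    refine h.congr_deriv ?_
    simp only [Pi.neg_apply]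
    ring
  have hWmono : MonotoneOn (fun r => v r * Real.exp (-(∫ τ in (0 : ℝ)..r, e' * y τ))) (Icc 0 T) := by
    refine monotoneOn_of_deriv_nonneg (convex_Icc 0 T)
      (fun s _ => (hW s).continuousAt.continuousWithinAt)
      (fun s _ => (hW s).differentiableAt.differentiableWithinAt) fun s hs => ?_
    rw [interior_Icc] at hs
    rw [(hW s).deriv]
    have h1 := hxT s ⟨hs.1.le, hs.2.le⟩
    have h2 := (hupos s).le
    positivity
  have hvnn : ∀ t ∈ Icc 0 T, 0 ≤ v t := by
    intro t ht
    have h := hWmono (left_mem_Icc.2 hT) ht ht.1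
    simp only [intervalIntegral.integral_same, neg_zero, Real.exp_zero, mul_one] at h
    have hpos : 0 < Real.exp (-(∫ τ in (0 : ℝ)..t, e' * y τ)) := Real.exp_pos _
    nlinarith
  refine ⟨hupos, hynn, hvnn, ?_⟩
  -- seed deposit: v' ≥ β x u on [0, T]
  have hv'c : Continuous fun s => β * x s * u s + e' * y s * v s :=
    ((continuous_const.mul hxc).mul huc).add ((continuous_const.mul hyc).mul hvc)
  have hxuc : Continuous fun s => β * (x s * u s) := continuous_const.mul (hxc.mul huc)
  have hFTC : ∫ s in (0 : ℝ)..T, (β * x s * u s + e' * y s * v s) = v T - v 0 :=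
    intervalIntegral.integral_eq_sub_of_hasDerivAt (fun s _ => hv s) (hv'c.intervalIntegrable 0 T)
  have hmono : ∫ s in (0 : ℝ)..T, β * (x s * u s) ≤ ∫ s in (0 : ℝ)..T, (β * x s * u s + e' * y s * v s) := by
    refine intervalIntegral.integral_mono_on hT (hxuc.intervalIntegrable 0 T)
      (hv'c.intervalIntegrable 0 T) fun s hs => ?_
    have h1 : 0 ≤ e' * y s * v s := mul_nonneg (mul_nonneg he' (hynn s hs.1)) (hvnn s hs)
    linarith
  rw [intervalIntegral.integral_const_mul] at hmono
  linarith

/-! ### Correction (same author, same session, 2026-08-28)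

The receiver equation of the seeded two-shell truncation of the pinned table is `y′ = gu² − e′v²` (the
upper trigger drains the receiver through the cancelling partner `α(i₁,i₁,i₀,(0,0,0)) = −e` at shell
`n+1`), NOT `y′ = gu² − e′yv²` as written in the two declarations
`heteroclinicTriggerChain_trunc_receiver_nonneg` and `heteroclinicTriggerChain_trunc_seed_deposit` above
(which remain true statements about that other ODE and are DEPRECATED below; `_trunc_trigger_formula` does
not involve the receiver equation and stands). The declarations of this section use the correct system,
certified by energy conservation (`heteroclinicTriggerChain_trunc_energy`). -/

/-- **Energy conservation** in the seeded two-shell truncation: `x² + u² + y² + v²` is constant (the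
truncated table is cancelling). [folklore] -/
theorem heteroclinicTriggerChain_trunc_energy (e g e' β : ℝ) (x u y v : ℝ → ℝ)
    (hx : ∀ t, HasDerivAt x (-(e * u t ^ 2) - β * u t * v t) t)
    (hu : ∀ t, HasDerivAt u (e * x t * u t - g * u t * y t) t)
    (hy : ∀ t, HasDerivAt y (g * u t ^ 2 - e' * v t ^ 2) t)
    (hv : ∀ t, HasDerivAt v (β * x t * u t + e' * y t * v t) t) (t : ℝ) :
    x t ^ 2 + u t ^ 2 + y t ^ 2 + v t ^ 2 = x 0 ^ 2 + u 0 ^ 2 + y 0 ^ 2 + v 0 ^ 2 := by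
  have hE : ∀ s, HasDerivAt (fun r => x r ^ 2 + u r ^ 2 + y r ^ 2 + v r ^ 2) 0 s := by
    intro s
    have h := ((((hx s).mul (hx s)).add ((hu s).mul (hu s))).add ((hy s).mul (hy s))).add
      ((hv s).mul (hv s))
    have h' : HasDerivAt (fun r => x r * x r + u r * u r + y r * y r + v r * v r) 0 s :=
      h.congr_deriv (by ring)
    refine (h'.congr_of_eventuallyEq (Filter.Eventually.of_forall fun r => ?_))
    simp only [sq]
  exact is_const_of_deriv_eq_zero (fun s => (hE s).differentiableAt) (fun s => (hE s).deriv) t 0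

/-- **Receiver balance**: if `y′ = gu² − e′v²` then `y(t) = y(0) + ∫₀ᵗ (gu² − e′v²)`; in particular the
receiver is nonnegative at time `t ≥ 0` whenever the upper trigger has drained no more than the initial
content plus the pump supplied, `e′∫₀ᵗ v² ≤ y(0) + g∫₀ᵗ u²`. [folklore] -/
theorem heteroclinicTriggerChain_trunc_receiver_balance (g e' : ℝ) (u y v : ℝ → ℝ)
    (huc : Continuous u) (hvc : Continuous v)
    (hy : ∀ t, HasDerivAt y (g * u t ^ 2 - e' * v t ^ 2) t) {t : ℝ}
    (hdrain : e' * ∫ s in (0 : ℝ)..t, v s ^ 2 ≤ y 0 + g * ∫ s in (0 : ℝ)..t, u s ^ 2) : 0 ≤ y t := by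
  have hc : Continuous fun s => g * u s ^ 2 - e' * v s ^ 2 :=
    (continuous_const.mul (huc.pow 2)).sub (continuous_const.mul (hvc.pow 2))
  have hFTC : ∫ s in (0 : ℝ)..t, (g * u s ^ 2 - e' * v s ^ 2) = y t - y 0 :=
    intervalIntegral.integral_eq_sub_of_hasDerivAt (fun s _ => hy s) (hc.intervalIntegrable 0 t)
  have hi1 : IntervalIntegrable (fun s => g * u s ^ 2) volume 0 t :=
    (continuous_const.mul (huc.pow 2)).intervalIntegrable 0 t
  have hi2 : IntervalIntegrable (fun s => e' * v s ^ 2) volume 0 t :=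
    (continuous_const.mul (hvc.pow 2)).intervalIntegrable 0 t
  rw [intervalIntegral.integral_sub hi1 hi2, intervalIntegral.integral_const_mul,
    intervalIntegral.integral_const_mul] at hFTC
  linarith

/-- **The carrier only loses** while the triggers are charged: on a window where `v ≥ 0` (and `u > 0`,
`β ≥ 0`, `e ≥ 0`), `x` is non-increasing. [folklore] -/
theorem heteroclinicTriggerChain_trunc_carrier_antitone (e β : ℝ) (he : 0 ≤ e) (hβ : 0 ≤ β)
    (x u v : ℝ → ℝ) (hx : ∀ t, HasDerivAt x (-(e * u t ^ 2) - β * u t * v t) t) {T : ℝ}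
    (hu : ∀ t ∈ Icc 0 T, 0 ≤ u t) (hv : ∀ t ∈ Icc 0 T, 0 ≤ v t) : AntitoneOn x (Icc 0 T) := by
  refine antitoneOn_of_deriv_nonpos (convex_Icc 0 T) (fun s _ => (hx s).continuousAt.continuousWithinAt)
    (fun s _ => (hx s).differentiableAt.differentiableWithinAt) fun s hs => ?_
  rw [interior_Icc] at hs
  rw [(hx s).deriv]
  have h1 := hu s ⟨hs.1.le, hs.2.le⟩
  have h2 := hv s ⟨hs.1.le, hs.2.le⟩
  have h3 : 0 ≤ e * u s ^ 2 := by positivity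
  have h4 : 0 ≤ β * u s * v s := by positivity
  linarith

/-- **SEED DEPOSIT in the seeded two-shell truncation** (helper for item stmt-NavierStokesRegularity-22785).
For the system `x′ = −eu² − βuv`, `u′ = exu − guy`, `y′ = gu² − e′v²`, `v′ = βxu + e′yv` with `e′, β ≥ 0`, a
pre-hop state `u(0) > 0`, `v(0) ≥ 0`, and a window `[0,T]` on which the carrier and the receiver stay
nonnegative: the trigger stays positive, the upper trigger stays nonnegative on the window, and it collects
at least the seed forcing: `v(T) ≥ v(0) + β ∫₀ᵀ x u`. [folklore] -/
theorem heteroclinicTriggerChain_trunc_seedDeposit (e g e' β : ℝ) (he' : 0 ≤ e') (hβ : 0 ≤ β)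
    (x u y v : ℝ → ℝ)
    (hx : ∀ t, HasDerivAt x (-(e * u t ^ 2) - β * u t * v t) t)
    (hu : ∀ t, HasDerivAt u (e * x t * u t - g * u t * y t) t)
    (hy : ∀ t, HasDerivAt y (g * u t ^ 2 - e' * v t ^ 2) t)
    (hv : ∀ t, HasDerivAt v (β * x t * u t + e' * y t * v t) t)
    (hu0 : 0 < u 0) (hv0 : 0 ≤ v 0) {T : ℝ} (hT : 0 ≤ T)
    (hxT : ∀ s ∈ Icc 0 T, 0 ≤ x s) (hyT : ∀ s ∈ Icc 0 T, 0 ≤ y s) :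
    (∀ t, 0 < u t) ∧ (∀ t ∈ Icc 0 T, 0 ≤ v t) ∧
      v 0 + β * ∫ s in (0 : ℝ)..T, x s * u s ≤ v T := by
  have hxc : Continuous x := continuous_iff_continuousAt.2 fun t => (hx t).continuousAt
  have huc : Continuous u := continuous_iff_continuousAt.2 fun t => (hu t).continuousAt
  have hyc : Continuous y := continuous_iff_continuousAt.2 fun t => (hy t).continuousAt
  have hvc : Continuous v := continuous_iff_continuousAt.2 fun t => (hv t).continuousAt
  -- trigger sign
  have hupos : ∀ t, 0 < u t := fun t => by
    rw [heteroclinicTriggerChain_trunc_trigger_formula e g x u y hxc hyc hu t]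
    exact mul_pos hu0 (Real.exp_pos _)
  -- upper trigger sign on [0, T], via W := v · exp(−∫ e' y)
  have hfc : Continuous fun s => e' * y s := continuous_const.mul hyc
  have hΦ := htcST_hasDerivAt_primitive hfc
  have hW : ∀ s, HasDerivAt (fun r => v r * Real.exp (-(∫ τ in (0 : ℝ)..r, e' * y τ)))
      (β * x s * u s * Real.exp (-(∫ τ in (0 : ℝ)..s, e' * y τ))) s := by
    intro s
    have h := (hv s).mul (hΦ s).neg.exp
    refine h.congr_deriv ?_
    simp only [Pi.neg_apply]
    ring
  have hWmono : MonotoneOn (fun r => v r * Real.exp (-(∫ τ in (0 : ℝ)..r, e' * y τ))) (Icc 0 T) := by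
    refine monotoneOn_of_deriv_nonneg (convex_Icc 0 T)
      (fun s _ => (hW s).continuousAt.continuousWithinAt)
      (fun s _ => (hW s).differentiableAt.differentiableWithinAt) fun s hs => ?_
    rw [interior_Icc] at hs
    rw [(hW s).deriv]
    have h1 := hxT s ⟨hs.1.le, hs.2.le⟩
    have h2 := (hupos s).le
    positivity
  have hvnn : ∀ t ∈ Icc 0 T, 0 ≤ v t := by
    intro t ht
    have h := hWmono (left_mem_Icc.2 hT) ht ht.1
    simp only [intervalIntegral.integral_same, neg_zero, Real.exp_zero, mul_one] at h
    have hpos : 0 < Real.exp (-(∫ τ in (0 : ℝ)..t, e' * y τ)) := Real.exp_pos _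
    nlinarith
  refine ⟨hupos, hvnn, ?_⟩
  -- seed deposit: v' ≥ β x u on [0, T]
  have hv'c : Continuous fun s => β * x s * u s + e' * y s * v s :=
    ((continuous_const.mul hxc).mul huc).add ((continuous_const.mul hyc).mul hvc)
  have hxuc : Continuous fun s => β * (x s * u s) := continuous_const.mul (hxc.mul huc)
  have hFTC : ∫ s in (0 : ℝ)..T, (β * x s * u s + e' * y s * v s) = v T - v 0 :=
    intervalIntegral.integral_eq_sub_of_hasDerivAt (fun s _ => hv s) (hv'c.intervalIntegrable 0 T)
  have hmono : ∫ s in (0 : ℝ)..T, β * (x s * u s) ≤ ∫ s in (0 : ℝ)..T, (β * x s * u s + e' * y s * v s) := by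
    refine intervalIntegral.integral_mono_on hT (hxuc.intervalIntegrable 0 T)
      (hv'c.intervalIntegrable 0 T) fun s hs => ?_
    have h1 : 0 ≤ e' * y s * v s := mul_nonneg (mul_nonneg he' (hyT s hs)) (hvnn s hs)
    linarith
  rw [intervalIntegral.integral_const_mul] at hmono
  linarith

/-- **SEED DEPOSIT, TWO-SIDED**: in the setting of `heteroclinicTriggerChain_trunc_seedDeposit` the upper
trigger at the end of the window is pinched between the bare seed integral and its amplification by the
receiver-driven growth `e′y`: `v(0) + β∫₀ᵀ xu ≤ v(T) ≤ (v(0) + β∫₀ᵀ xu) · exp(∫₀ᵀ e′y)`. The amplification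
factor `exp(e′∫₀ᵀ y)` is the PREMATURE-IGNITION factor of the route's numerics (the upper clock `e′ = 2^{5/2}e`
runs while the receiver `y` fills). [folklore] -/
theorem heteroclinicTriggerChain_trunc_seedDeposit_le (e g e' β : ℝ) (he' : 0 ≤ e') (hβ : 0 ≤ β)
    (x u y v : ℝ → ℝ)
    (hx : ∀ t, HasDerivAt x (-(e * u t ^ 2) - β * u t * v t) t)
    (hu : ∀ t, HasDerivAt u (e * x t * u t - g * u t * y t) t)
    (hy : ∀ t, HasDerivAt y (g * u t ^ 2 - e' * v t ^ 2) t)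
    (hv : ∀ t, HasDerivAt v (β * x t * u t + e' * y t * v t) t)
    (hu0 : 0 < u 0) (hv0 : 0 ≤ v 0) {T : ℝ} (hT : 0 ≤ T)
    (hxT : ∀ s ∈ Icc 0 T, 0 ≤ x s) (hyT : ∀ s ∈ Icc 0 T, 0 ≤ y s) :
    v 0 + β * ∫ s in (0 : ℝ)..T, x s * u s ≤ v T ∧
      v T ≤ (v 0 + β * ∫ s in (0 : ℝ)..T, x s * u s) * Real.exp (∫ s in (0 : ℝ)..T, e' * y s) := by
  obtain ⟨hupos, hvnn, hlow⟩ :=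
    heteroclinicTriggerChain_trunc_seedDeposit e g e' β he' hβ x u y v hx hu hy hv hu0 hv0 hT hxT hyT
  refine ⟨hlow, ?_⟩
  have hxc : Continuous x := continuous_iff_continuousAt.2 fun t => (hx t).continuousAt
  have huc : Continuous u := continuous_iff_continuousAt.2 fun t => (hu t).continuousAt
  have hyc : Continuous y := continuous_iff_continuousAt.2 fun t => (hy t).continuousAt
  have hfc : Continuous fun s => e' * y s := continuous_const.mul hyc
  have hΦ := htcST_hasDerivAt_primitive hfc
  -- W := v · exp(−Φ), W' = β x u · exp(−Φ) ≤ β x u on [0, T] (Φ ≥ 0 there)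
  have hW : ∀ s, HasDerivAt (fun r => v r * Real.exp (-(∫ τ in (0 : ℝ)..r, e' * y τ)))
      (β * x s * u s * Real.exp (-(∫ τ in (0 : ℝ)..s, e' * y τ))) s := by
    intro s
    have h := (hv s).mul (hΦ s).neg.exp
    refine h.congr_deriv ?_
    simp only [Pi.neg_apply]
    ring
  have hΦnn : ∀ s ∈ Icc 0 T, 0 ≤ ∫ τ in (0 : ℝ)..s, e' * y τ := fun s hs =>
    intervalIntegral.integral_nonneg hs.1 fun τ hτ => mul_nonneg he' (hyT τ ⟨hτ.1, hτ.2.trans hs.2⟩)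
  have hW'c : Continuous fun s => β * x s * u s * Real.exp (-(∫ τ in (0 : ℝ)..s, e' * y τ)) :=
    ((continuous_const.mul hxc).mul huc).mul
      (continuous_iff_continuousAt.2 fun s => ((hΦ s).neg.exp).continuousAt)
  have hxuc : Continuous fun s => β * (x s * u s) := continuous_const.mul (hxc.mul huc)
  have hFTC : ∫ s in (0 : ℝ)..T, β * x s * u s * Real.exp (-(∫ τ in (0 : ℝ)..s, e' * y τ)) =
      v T * Real.exp (-(∫ τ in (0 : ℝ)..T, e' * y τ)) - v 0 * Real.exp (-(∫ τ in (0 : ℝ)..0, e' * y τ)) :=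
    intervalIntegral.integral_eq_sub_of_hasDerivAt (fun s _ => hW s) (hW'c.intervalIntegrable 0 T)
  rw [intervalIntegral.integral_same, neg_zero, Real.exp_zero, mul_one] at hFTC
  have hmono : ∫ s in (0 : ℝ)..T, β * x s * u s * Real.exp (-(∫ τ in (0 : ℝ)..s, e' * y τ)) ≤
      ∫ s in (0 : ℝ)..T, β * (x s * u s) := by
    refine intervalIntegral.integral_mono_on hT (hW'c.intervalIntegrable 0 T)
      (hxuc.intervalIntegrable 0 T) fun s hs => ?_
    have h1 : Real.exp (-(∫ τ in (0 : ℝ)..s, e' * y τ)) ≤ 1 := by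
      rw [Real.exp_le_one_iff]
      linarith [hΦnn s hs]
    have h2 : 0 ≤ β * (x s * u s) := mul_nonneg hβ (mul_nonneg (hxT s hs) (hupos s).le)
    have h3 : 0 < Real.exp (-(∫ τ in (0 : ℝ)..s, e' * y τ)) := Real.exp_pos _
    nlinarith
  rw [intervalIntegral.integral_const_mul] at hmono
  have hkey : v T * Real.exp (-(∫ τ in (0 : ℝ)..T, e' * y τ)) ≤ v 0 + β * ∫ s in (0 : ℝ)..T, x s * u s := by
    linarith
  have hpos : 0 < Real.exp (∫ τ in (0 : ℝ)..T, e' * y τ) := Real.exp_pos _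
  have h := mul_le_mul_of_nonneg_right hkey hpos.le
  rwa [mul_assoc, ← Real.exp_add, neg_add_cancel, Real.exp_zero, mul_one] at h

attribute [deprecated heteroclinicTriggerChain_trunc_receiver_balance (since := "2026-08-28")]
  heteroclinicTriggerChain_trunc_receiver_nonneg
attribute [deprecated heteroclinicTriggerChain_trunc_seedDeposit (since := "2026-08-28")]
  heteroclinicTriggerChain_trunc_seed_deposit

/-! ### Budget identities of the hop (integrated equations of motion) -/

/-- **Carrier budget**: `x(T) = x(0) − e∫₀ᵀ u² − β∫₀ᵀ uv` — what the carrier loses over the window is the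
pump work `e∫u²` plus the seed work `β∫uv`. [folklore] -/
theorem heteroclinicTriggerChain_trunc_carrier_budget (e β : ℝ) (x u v : ℝ → ℝ)
    (huc : Continuous u) (hvc : Continuous v)
    (hx : ∀ t, HasDerivAt x (-(e * u t ^ 2) - β * u t * v t) t) (T : ℝ) :
    x T = x 0 - e * (∫ s in (0 : ℝ)..T, u s ^ 2) - β * (∫ s in (0 : ℝ)..T, u s * v s) := by
  have hi1 : IntervalIntegrable (fun s => -(e * u s ^ 2)) volume 0 T :=
    (continuous_const.mul (huc.pow 2)).neg.intervalIntegrable 0 T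
  have hi2 : IntervalIntegrable (fun s => β * u s * v s) volume 0 T :=
    ((continuous_const.mul huc).mul hvc).intervalIntegrable 0 T
  have hc : Continuous fun s => -(e * u s ^ 2) - β * u s * v s :=
    (continuous_const.mul (huc.pow 2)).neg.sub ((continuous_const.mul huc).mul hvc)
  have hFTC : ∫ s in (0 : ℝ)..T, (-(e * u s ^ 2) - β * u s * v s) = x T - x 0 :=
    intervalIntegral.integral_eq_sub_of_hasDerivAt (fun s _ => hx s) (hc.intervalIntegrable 0 T)
  have h3 : ∫ s in (0 : ℝ)..T, β * u s * v s = β * ∫ s in (0 : ℝ)..T, u s * v s := by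
    rw [← intervalIntegral.integral_const_mul]
    exact intervalIntegral.integral_congr fun s _ => by ring
  rw [intervalIntegral.integral_sub hi1 hi2, intervalIntegral.integral_neg,
    intervalIntegral.integral_const_mul, h3] at hFTC
  linarith

/-- **Receiver budget**: `y(T) = y(0) + g∫₀ᵀ u² − e′∫₀ᵀ v²` — the receiver gains the pump work and loses
what its own trigger drains. [folklore] -/
theorem heteroclinicTriggerChain_trunc_receiver_budget (g e' : ℝ) (u y v : ℝ → ℝ)
    (huc : Continuous u) (hvc : Continuous v)
    (hy : ∀ t, HasDerivAt y (g * u t ^ 2 - e' * v t ^ 2) t) (T : ℝ) :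
    y T = y 0 + g * (∫ s in (0 : ℝ)..T, u s ^ 2) - e' * (∫ s in (0 : ℝ)..T, v s ^ 2) := by
  have hi1 : IntervalIntegrable (fun s => g * u s ^ 2) volume 0 T :=
    (continuous_const.mul (huc.pow 2)).intervalIntegrable 0 T
  have hi2 : IntervalIntegrable (fun s => e' * v s ^ 2) volume 0 T :=
    (continuous_const.mul (hvc.pow 2)).intervalIntegrable 0 T
  have hc : Continuous fun s => g * u s ^ 2 - e' * v s ^ 2 :=
    (continuous_const.mul (huc.pow 2)).sub (continuous_const.mul (hvc.pow 2))
  have hFTC : ∫ s in (0 : ℝ)..T, (g * u s ^ 2 - e' * v s ^ 2) = y T - y 0 :=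
    intervalIntegral.integral_eq_sub_of_hasDerivAt (fun s _ => hy s) (hc.intervalIntegrable 0 T)
  rw [intervalIntegral.integral_sub hi1 hi2, intervalIntegral.integral_const_mul,
    intervalIntegral.integral_const_mul] at hFTC
  linarith

/-- **Transfer budget**: combining the two budgets when `g = e` (the complete-transfer tuning forced by the
connection clause in the two-mode sector), the receiver's gain equals the carrier's loss minus the seed work
minus the upper drain: `y(T) − y(0) = (x(0) − x(T)) − β∫₀ᵀ uv − e′∫₀ᵀ v²`. [folklore] -/
theorem heteroclinicTriggerChain_trunc_transfer_budget (e e' β : ℝ) (x u y v : ℝ → ℝ)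
    (huc : Continuous u) (hvc : Continuous v)
    (hx : ∀ t, HasDerivAt x (-(e * u t ^ 2) - β * u t * v t) t)
    (hy : ∀ t, HasDerivAt y (e * u t ^ 2 - e' * v t ^ 2) t) (T : ℝ) :
    y T - y 0 = (x 0 - x T) - β * (∫ s in (0 : ℝ)..T, u s * v s) - e' * (∫ s in (0 : ℝ)..T, v s ^ 2) := by
  have h1 := heteroclinicTriggerChain_trunc_carrier_budget e β x u v huc hvc hx T
  have h2 := heteroclinicTriggerChain_trunc_receiver_budget e e' u y v huc hvc hy T
  linarith

end Summit.NavierStokesRegularity.NavierStokesRegularity.Theorems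

end
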